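import Summits.ResolutionOfSingularities.ResolutionOfSingularities.Theorems.PurelyInseparableDim4ResConeShadeTwoCorner
import Summits.ResolutionOfSingularities.ResolutionOfSingularities.Theorems.PurelyInseparableDim4ResConeExceptionalRestriction
import Summits.ResolutionOfSingularities.ResolutionOfSingularities.Theorems.PurelyInseparableDim4ResConeBinaryPersist
import Mathlib.Data.Finsupp.Antidiagonal
import HarnessLib
import HarnessLib.Audit.Tags

/-!
# Purely inseparable four-folds — K2(p), PHASE `d = 2`, PART V: FINITE BRANCHING of the translated steps (every
# prime; idea-4 I-4-6 (FB))

[OURS · counted 0 · cell `res-dim4-pi` · seat res-dim4-p-7 g3 · K2(p) lane (holder res-dim4-p-12 lineage; desk WORDs #82 (c),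
#96 (a)); hand analysis res-dim4-idea-4 (card I-4-6 (FB)).]  Nothing here proves K2(p), `NoIsolatedTrap p p`, or resolution of
singularities in dimension ≥ 4 / characteristic `p`.  AI kernel work, weaker than expert review.

One shade-keeping point step `s → s′ = step p univ j b s` between ISOLATED shade-`2` states off the floor with `x^r ∣ F`
(`ord₀ F = W + 2`, `p ≤ W + 1`, `W + 4 ≤ 2p`; `…ShadeTwoStep`):
* §1 **`exists_two_kept`** — at least two boundary letters `i, i′ ≠ j` are KEPT (`b_i = 0`, `r_i ≥ 1`): otherwise
  `W′ = (W + 2 − p) + σ` is `≤ p − 2` by the child's pair bound `r′_j + r′_i ≤ p − 2`; hence **`moved_letter_unique`**: at most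
  ONE letter `f` is translated (`b_f ≠ 0`) — NO CONTINUOUS FAMILIES in the `d = 2` phase — and the ledger of a translated step:
  `r′_f = 0`, `r′_j = W + 2 − p`, the two kept letters keep their multiplicities, `W′ = p − 1` (`shadeTwo_step_degree_of_loss`).
* §2 **`coeff_sq_ne_zero_of_step_r_eq_zero`** — if a letter `f ≠ j` is not on the child's boundary (`r′_f = 0`: `f` was
  translated, or was free) then `x_f² ∈ supp g` (`q_ff ≠ 0`): the child's `x_f`-axis has weight `W′ = p − 1`, so legality needs
  a pure power `x_f^n ∈ G′`, and `G′|_{x_j = 0} = ∏_{lost} (x_i + b_i)^{r_i} · shear_j(b) g` (p-3 g3's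
  `killVar_divMonomial_step`) carries the pure `x_f`-powers `∝ q_ff`.  **`coeff_sq_resForm_step_ne_zero`**: the child inherits it,
  `q′_ff = c · q_ff ≠ 0` — the persistent square of the free / lost letter (idea-4 I-4-6 «q_ff ≠ 0 persists»).
Sequel: `…ResConeShadeTwoLocated` (after the first translated step the chain lives in the `c = 3` classes with a persistent
square on the free letter; the located `d = 2` residue is the two-light-letter α-tail).
bears_on: LADDER-RESOLUTION:D157-DOOR2 (res-dim4-pi · K2(p) · phase d = 2).  Supports stmt-ResolutionOfSingularities-16155
(helper).
-/

set_option linter.dupNamespace false -- mandated namespace of this single-conjunct summit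

noncomputable section

namespace Summit.ResolutionOfSingularities.ResolutionOfSingularities.Theorems.PIDim4

namespace ResCone

open MvPolynomial Finset
open Literature.AlgebraicGeometry.Resolution
open Literature.AlgebraicGeometry.Resolution.CentreBlowup
open Literature.AlgebraicGeometry.Resolution.Hauser2010
open Literature.AlgebraicGeometry.Resolution.HauserPerlega2019

variable {K : Type} [Field K]

/-- Four letters: two letters avoiding three pairwise distinct letters coincide. [folklore] -/
theorem fin4_eq_of_forall_ne {j i i' f f' : Fin 4} (hji : j ≠ i) (hji' : j ≠ i') (hii' : i ≠ i')
    (hf : f ≠ j ∧ f ≠ i ∧ f ≠ i') (hf' : f' ≠ j ∧ f' ≠ i ∧ f' ≠ i') : f = f' := by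
  revert j i i' f f'
  decide

section Step

variable [DecidableEq K] {p : ℕ} {s : State K} {j : Fin 4} {b : Fin 4 → K} {W : ℕ}

/-! ## §1 Two boundary letters are kept; at most one letter moves -/

/-- **TWO BOUNDARY LETTERS ARE KEPT** (idea-4 I-4-6 (FB), every prime): at a shade-keeping step between isolated shade-`2`
states off the floor, at least two letters `i, i′ ≠ j` have `b_i = 0` and `r_i ≥ 1`. [OURS · K2(p) phase d = 2] [folklore] -/
theorem exists_two_kept (hp2 : 2 ≤ p) (hbj : b j = 0) (ho : ordZero s.F = ((W + 2 : ℕ) : ℕ∞))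
    (hr : ∀ e ∈ s.F.support, s.r ≤ e) (hW2 : W + 4 ≤ 2 * p)
    (hiso' : IsIsolated p (CentreBlowup.step p Finset.univ j b s).F)
    (hr' : ∀ e ∈ (CentreBlowup.step p Finset.univ j b s).F.support, (CentreBlowup.step p Finset.univ j b s).r ≤ e)
    (hpW' : p ≤ (CentreBlowup.step p Finset.univ j b s).r.degree + 1) :
    ∃ i i', i ≠ i' ∧ i ≠ j ∧ i' ≠ j ∧ b i = 0 ∧ b i' = 0 ∧ 1 ≤ s.r i ∧ 1 ≤ s.r i' := by
  by_contra hno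
  have hdeg := degree_step_r' p j b s ho
  have hr'eq := shadeTwo_step_r (p := p) j hbj s ho hr
  set T := (Finset.univ : Finset (Fin 4)).erase j with hT
  -- the kept letters carry at most one non-zero multiplicity
  have huniq : ∀ i ∈ T, ∀ i' ∈ T, b i = 0 → b i' = 0 → 1 ≤ s.r i → 1 ≤ s.r i' → i = i' := by
    intro i hi i' hi' hbi hbi' hri hri'
    by_contra hne
    exact hno ⟨i, i', hne, Finset.ne_of_mem_erase hi, Finset.ne_of_mem_erase hi', hbi, hbi', hri, hri'⟩
  -- the child's pair bound `r′_j + r′_i ≤ p − 2` for a kept letter `i`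
  have hpair : ∀ i ∈ T, b i = 0 →
      (W + 2 - p) + s.r i ≤ p - 2 := by
    intro i hi hbi
    have hij : i ≠ j := Finset.ne_of_mem_erase hi
    have h := IsolatedBand.apply_add_apply_le_of_isIsolated hp2 hiso' hr' (Ne.symm hij)
    rw [hr'eq, Finsupp.update_apply, if_pos rfl, Finsupp.update_apply, if_neg hij, Finsupp.filter_apply,
      if_pos hbi] at h
    exact h
  rcases Classical.em (∃ i₀ ∈ T, b i₀ = 0 ∧ 1 ≤ s.r i₀) with ⟨i₀, hi₀, hbi₀, hri₀⟩ | hnone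
  · -- one kept letter: `σ = r_{i₀}` and `W′ = r′_j + r′_{i₀} ≤ p − 2`
    have hσ : ∑ i ∈ T, (if b i = 0 then s.r i else 0) = s.r i₀ := by
      rw [Finset.sum_eq_single_of_mem i₀ hi₀ (fun i hi hne => ?_), if_pos hbi₀]
      by_cases hbi : b i = 0
      · rw [if_pos hbi]
        by_contra hri
        exact hne (huniq i hi i₀ hi₀ hbi hbi₀ (Nat.one_le_iff_ne_zero.mpr hri) hri₀)
      · rw [if_neg hbi]
    rw [hσ] at hdeg
    have := hpair i₀ hi₀ hbi₀
    omega
  · -- no kept letter: `W′ = W + 2 − p ≤ p − 2`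
    have hσ : ∑ i ∈ T, (if b i = 0 then s.r i else 0) = 0 := by
      refine Finset.sum_eq_zero fun i hi => ?_
      by_cases hbi : b i = 0
      · rw [if_pos hbi]
        by_contra hri
        exact hnone ⟨i, hi, hbi, Nat.one_le_iff_ne_zero.mpr hri⟩
      · rw [if_neg hbi]
    rw [hσ] at hdeg
    omega

/-- **AT MOST ONE LETTER MOVES** — no continuous families in the `d = 2` phase: two translated letters `b_f ≠ 0 ≠ b_{f′}`
coincide. [OURS · K2(p) phase d = 2] [folklore] -/
theorem moved_letter_unique (hp2 : 2 ≤ p) (hbj : b j = 0) (ho : ordZero s.F = ((W + 2 : ℕ) : ℕ∞))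
    (hr : ∀ e ∈ s.F.support, s.r ≤ e) (hW2 : W + 4 ≤ 2 * p)
    (hiso' : IsIsolated p (CentreBlowup.step p Finset.univ j b s).F)
    (hr' : ∀ e ∈ (CentreBlowup.step p Finset.univ j b s).F.support, (CentreBlowup.step p Finset.univ j b s).r ≤ e)
    (hpW' : p ≤ (CentreBlowup.step p Finset.univ j b s).r.degree + 1) {f f' : Fin 4} (hf : b f ≠ 0)
    (hf' : b f' ≠ 0) : f = f' := by
  obtain ⟨i, i', hii', hij, hi'j, hbi, hbi', -, -⟩ := exists_two_kept hp2 hbj ho hr hW2 hiso' hr' hpW'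
  exact fin4_eq_of_forall_ne (Ne.symm hij) (Ne.symm hi'j) hii'
    ⟨fun h => hf (h ▸ hbj), fun h => hf (h ▸ hbi), fun h => hf (h ▸ hbi')⟩
    ⟨fun h => hf' (h ▸ hbj), fun h => hf' (h ▸ hbi), fun h => hf' (h ▸ hbi')⟩

/-- **The other two letters are kept boundary letters** when `f` moves. [OURS · K2(p) phase d = 2] [folklore] -/
theorem kept_of_moved (hp2 : 2 ≤ p) (hbj : b j = 0) (ho : ordZero s.F = ((W + 2 : ℕ) : ℕ∞))
    (hr : ∀ e ∈ s.F.support, s.r ≤ e) (hW2 : W + 4 ≤ 2 * p)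
    (hiso' : IsIsolated p (CentreBlowup.step p Finset.univ j b s).F)
    (hr' : ∀ e ∈ (CentreBlowup.step p Finset.univ j b s).F.support, (CentreBlowup.step p Finset.univ j b s).r ≤ e)
    (hpW' : p ≤ (CentreBlowup.step p Finset.univ j b s).r.degree + 1) {f : Fin 4} (hf : b f ≠ 0) :
    ∀ i, i ≠ j → i ≠ f → b i = 0 ∧ 1 ≤ s.r i := by
  obtain ⟨i, i', hii', hij, hi'j, hbi, hbi', hri, hri'⟩ := exists_two_kept hp2 hbj ho hr hW2 hiso' hr' hpW'
  have hfj : f ≠ j := fun h => hf (h ▸ hbj)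
  have hfi : f ≠ i := fun h => hf (h ▸ hbi)
  have hfi' : f ≠ i' := fun h => hf (h ▸ hbi')
  intro k hkj hkf
  -- `k` is one of the two kept letters
  by_cases hki : k = i
  · exact ⟨hki ▸ hbi, hki ▸ hri⟩
  · by_cases hki' : k = i'
    · exact ⟨hki' ▸ hbi', hki' ▸ hri'⟩
    · exact absurd (fin4_eq_of_forall_ne (Ne.symm hij) (Ne.symm hi'j) hii' ⟨hkj, hki, hki'⟩ ⟨hfj, hfi, hfi'⟩) hkf

/-- **The ledger of a translated step**: the moved letter leaves the boundary (`r′_f = 0`), the chart letter carries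
`r′_j = W + 2 − p`, the other two keep their (positive) multiplicities, and `W′ = p − 1`. [OURS · K2(p) phase d = 2]
[folklore] -/
theorem ledger_of_moved (hp2 : 2 ≤ p) (hbj : b j = 0) (ho : ordZero s.F = ((W + 2 : ℕ) : ℕ∞))
    (hr : ∀ e ∈ s.F.support, s.r ≤ e) (hW2 : W + 4 ≤ 2 * p)
    (hiso' : IsIsolated p (CentreBlowup.step p Finset.univ j b s).F)
    (hr' : ∀ e ∈ (CentreBlowup.step p Finset.univ j b s).F.support, (CentreBlowup.step p Finset.univ j b s).r ≤ e)
    (hpW' : p ≤ (CentreBlowup.step p Finset.univ j b s).r.degree + 1) {f : Fin 4} (hf : b f ≠ 0) :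
    (CentreBlowup.step p Finset.univ j b s).r f = 0 ∧ (CentreBlowup.step p Finset.univ j b s).r j = W + 2 - p ∧
      (∀ i, i ≠ j → i ≠ f → (CentreBlowup.step p Finset.univ j b s).r i = s.r i ∧ 1 ≤ s.r i) ∧
      (CentreBlowup.step p Finset.univ j b s).r.degree + 1 = p := by
  have hfj : f ≠ j := fun h => hf (h ▸ hbj)
  have hr'eq := shadeTwo_step_r (p := p) j hbj s ho hr
  have hkept := kept_of_moved hp2 hbj ho hr hW2 hiso' hr' hpW' hf
  refine ⟨?_, ?_, fun i hij hif => ⟨?_, (hkept i hij hif).2⟩, shadeTwo_step_degree_of_loss j hbj s ho hr hf hiso' hr' hpW'⟩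
  · rw [hr'eq, Finsupp.update_apply, if_neg hfj, Finsupp.filter_apply, if_neg hf]
  · rw [hr'eq, Finsupp.update_apply, if_pos rfl]
  · rw [hr'eq, Finsupp.update_apply, if_neg hij, Finsupp.filter_apply, if_pos (hkept i hij hif).1]

/-! ## §2 The persistent square of the free / lost letter -/

omit [DecidableEq K] in
/-- Coefficients of `x_j`-free monomials are unchanged by the shear along `x_j`. [folklore] -/
theorem coeff_shear_of_apply_eq_zero (j : Fin 4) (t : Fin 4 → K) (P : MvPolynomial (Fin 4) K) {ν : Fin 4 →₀ ℕ}
    (hν : ν j = 0) : coeff ν (shear j t P) = coeff ν P := by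
  have h := congrArg (coeff ν) (killVar_shear j t P)
  rwa [coeff_killVar, coeff_killVar, if_pos hν, if_pos hν] at h

omit [DecidableEq K] in
/-- Pure powers of one letter in a product: `coeff_{x_f^n} (P · Q) = Σ_{a + c = n} coeff_{x_f^a} P · coeff_{x_f^c} Q`.
[folklore] -/
theorem coeff_single_mul (f : Fin 4) (n : ℕ) (P Q : MvPolynomial (Fin 4) K) :
    coeff (Finsupp.single f n) (P * Q) =
      ∑ x ∈ Finset.HasAntidiagonal.antidiagonal n, coeff (Finsupp.single f x.1) P * coeff (Finsupp.single f x.2) Q := by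
  rw [MvPolynomial.coeff_mul, Finsupp.antidiagonal_single, Finset.sum_map]
  rfl

/-- **THE SQUARE OF A LETTER OFF THE CHILD'S BOUNDARY** (idea-4 I-4-6 (FB) «q_ff ≠ 0»): at a shade-keeping step between
isolated shade-`2` states off the floor, a letter `f ≠ j` with `r′_f = 0` (translated, or free) has `x_f² ∈ supp g`: the
child's `x_f`-axis has weight `W′ = p − 1`, so some pure power `x_f^n` lies in `G′`, and the pure `x_f`-powers of
`G′|_{x_j = 0} = ∏_{lost}(x_i + b_i)^{r_i} · shear g` are multiples of `q_ff`. [OURS · K2(p) phase d = 2] [folklore] -/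
theorem coeff_sq_ne_zero_of_step_r_eq_zero (hbj : b j = 0) (hW : s.r.degree = W)
    (ho : ordZero s.F = ((W + 2 : ℕ) : ℕ∞)) (hr : ∀ e ∈ s.F.support, s.r ≤ e) (hpW : p ≤ W + 1) (hW2 : W + 4 ≤ 2 * p)
    (heq : (CentreBlowup.step p Finset.univ j b s).shade = s.shade)
    (hiso' : IsIsolated p (CentreBlowup.step p Finset.univ j b s).F)
    (hr' : ∀ e ∈ (CentreBlowup.step p Finset.univ j b s).F.support, (CentreBlowup.step p Finset.univ j b s).r ≤ e)
    (hpW' : p ≤ (CentreBlowup.step p Finset.univ j b s).r.degree + 1) {f : Fin 4} (hfj : f ≠ j)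
    (hf : (CentreBlowup.step p Finset.univ j b s).r f = 0) : coeff (Finsupp.single f 2) (resForm s) ≠ 0 := by
  intro hq
  set s' := CentreBlowup.step p Finset.univ j b s with hs'
  have hqo : p < W + 2 := by omega
  have ho2 : W + 2 < 2 * p := by omega
  -- the child's weight and the legality of its `x_f`-axis
  have hW' : s'.r.degree + 1 = p := degree_add_one_eq_of_apply_eq_zero hiso' hr' rfl hpW' hf
  obtain ⟨e, he, hlt⟩ := exists_degree_lt_apply_add_of_isIsolated hiso' f
  have hle : s'.r ≤ e := hr' e he
  obtain ⟨m, rfl⟩ : ∃ m, e = s'.r + m := ⟨e - s'.r, (add_tsub_cancel_of_le hle).symm⟩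
  rw [map_add, Finsupp.add_apply, hf, zero_add] at hlt
  -- the witness is a pure power `x_f^n` above `x^{r′}`
  have hm0 : ∀ i, i ≠ f → m i = 0 := by
    intro i hif
    have := apply_add_apply_le_degree m hif
    have := Finsupp.le_degree f m
    omega
  have hmeq : m = Finsupp.single f (m f) := eq_single_of_forall m hm0
  set n := m f with hn
  -- it is a pure power of `G′`, hence of `G′|_{x_j = 0}`
  have hG : coeff (Finsupp.single f n) (PointBlowup.killVar j (s'.F.divMonomial s'.r)) ≠ 0 := by
    rw [coeff_killVar, if_pos (by rw [Finsupp.single_apply, if_neg hfj]), coeff_divMonomial, ← hmeq]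
    exact MvPolynomial.mem_support_iff.mp he
  rw [hs', killVar_divMonomial_step j hbj ho hr hqo ho2 heq, coeff_single_mul] at hG
  refine hG (Finset.sum_eq_zero fun x hx => ?_)
  -- every pure `x_f`-power of `shear g` is `[c = 2] · q_ff = 0`
  have hhom : (shear j b (resForm s)).IsHomogeneous (W + 2 - s.r.degree) := isHomogeneous_shear j b (resForm_isHomogeneous ho)
  by_cases hx2 : x.2 = 2
  · rw [hx2, coeff_shear_of_apply_eq_zero j b (resForm s) (by rw [Finsupp.single_apply, if_neg hfj]), hq, mul_zero]
  · have hzero : coeff (Finsupp.single f x.2) (shear j b (resForm s)) = 0 := by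
      by_contra hne
      have h := hhom hne
      rw [weight_one_eq_degree, Finsupp.degree_single, hW] at h
      omega
    rw [hzero, mul_zero]

/-- **THE SQUARE PERSISTS ON THE CHILD**: under the same hypotheses `x_f² ∈ supp g′`, indeed
`coeff_{2e_f} g′ = c · coeff_{2e_f} g` with `c = coeff_top (shear x^r) ≠ 0` (`…ResConeLayer`). [OURS · K2(p) phase d = 2]
[folklore] -/
theorem coeff_sq_resForm_step_ne_zero (hbj : b j = 0) (hW : s.r.degree = W)
    (ho : ordZero s.F = ((W + 2 : ℕ) : ℕ∞)) (hr : ∀ e ∈ s.F.support, s.r ≤ e) (hpW : p ≤ W + 1) (hW2 : W + 4 ≤ 2 * p)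
    (heq : (CentreBlowup.step p Finset.univ j b s).shade = s.shade)
    (hiso' : IsIsolated p (CentreBlowup.step p Finset.univ j b s).F)
    (hr' : ∀ e ∈ (CentreBlowup.step p Finset.univ j b s).F.support, (CentreBlowup.step p Finset.univ j b s).r ≤ e)
    (hpW' : p ≤ (CentreBlowup.step p Finset.univ j b s).r.degree + 1) {f : Fin 4} (hfj : f ≠ j)
    (hf : (CentreBlowup.step p Finset.univ j b s).r f = 0) :
    coeff (Finsupp.single f 2) (resForm (CentreBlowup.step p Finset.univ j b s)) ≠ 0 := by
  have hqo : p < W + 2 := by omega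
  have ho2 : W + 2 < 2 * p := by omega
  have hν : (Finsupp.single f 2 : Fin 4 →₀ ℕ) j = 0 := by rw [Finsupp.single_apply, if_neg hfj]
  rw [coeff_resForm_step_of_apply_eq_zero j hbj ho hr hqo ho2 heq hν, coeff_shear_of_apply_eq_zero j b _ hν]
  exact mul_ne_zero (coeff_topMonomial_ne_zero j hbj s.r)
    (coeff_sq_ne_zero_of_step_r_eq_zero hbj hW ho hr hpW hW2 heq hiso' hr' hpW' hfj hf)

/-- **A corner in the chart of a letter whose square is present is not a shade-keeping step**: if `x_j² ∈ supp g` then the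
corner step at `j` changes the shade (the quadric is not `x_j`-free; `not_mem_support_add_of_apply_ne_zero`). [OURS · K2(p)
phase d = 2] [folklore] -/
theorem shade_step_ne_of_coeff_sq_ne_zero (j : Fin 4) (hW : s.r.degree = W) (ho : ordZero s.F = ((W + 2 : ℕ) : ℕ∞))
    (hr : ∀ e ∈ s.F.support, s.r ≤ e) (hpW : p ≤ W + 1) (hW2 : W + 4 ≤ 2 * p)
    (hsq : coeff (Finsupp.single j 2) (resForm s) ≠ 0) :
    (CentreBlowup.step p Finset.univ j (0 : Fin 4 → K) s).shade ≠ s.shade := by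
  intro heq
  have h := not_mem_support_add_of_apply_ne_zero (p := p) j hW ho hr hpW hW2 heq (μ := Finsupp.single j 2)
    (by rw [Finsupp.degree_single]) (by rw [Finsupp.single_eq_same]; omega)
  rw [MvPolynomial.mem_support_iff, ← coeff_resForm_eq_coeff_add ho (by rw [Finsupp.degree_single, hW]; omega)
    (by rw [hW]; omega)] at h
  exact h hsq

/-! ## §3 The forced translation (appended) -/

/-- **THE FORCED TRANSLATION** (idea-4 I-4-6 (FB) «t_f = −q_fj / (2 q_ff)», every prime): at a shade-keeping step whose point
translates only the letter `f ≠ j` (`b_i = 0` for `i ≠ f`), the direction `e_j + b_f e_f` lies in the vertex of the quadric,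
whence `q_{jf} + 2 b_f q_{ff} = 0` (the `x_f`-coefficient of the polar `Σ_i v_i ∂_i g`).  With `q_ff ≠ 0`
(`coeff_sq_ne_zero_of_step_r_eq_zero`) the translation is DETERMINED by the quadric. [OURS · K2(p) phase d = 2] [folklore] -/
theorem forced_translation (hbj : b j = 0) (ho : ordZero s.F = ((W + 2 : ℕ) : ℕ∞)) (hr : ∀ e ∈ s.F.support, s.r ≤ e)
    (hpW : p ≤ W + 1) (hW2 : W + 4 ≤ 2 * p) (heq : (CentreBlowup.step p Finset.univ j b s).shade = s.shade) {f : Fin 4}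
    (hfj : f ≠ j) (hb : ∀ i, i ≠ f → b i = 0) :
    coeff (Finsupp.single j 1 + Finsupp.single f 1) (resForm s) + 2 * b f * coeff (Finsupp.single f 2) (resForm s) = 0 := by
  have hqo : p < W + 2 := by omega
  have ho2 : W + 2 < 2 * p := by omega
  have hmem := direction_mem_resVertex_of_shade_eq j hbj ho hr hqo ho2 heq
  unfold resVertex PointBlowup.additiveSubspace at hmem
  rw [LinearMap.mem_ker] at hmem
  have h := congrArg (coeff (Finsupp.single f 1)) hmem
  rw [NarrowApolarity.coeff_polarMap, coeff_zero, Finset.sum_eq_add_of_mem j f (Finset.mem_univ j) (Finset.mem_univ f)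
    hfj.symm (fun i _ hi => ?_)] at h
  · unfold PointBlowup.direction at h
    rw [Function.update_self, Function.update_of_ne hfj, Finsupp.single_apply, if_neg hfj, Finsupp.single_eq_same,
      add_comm (Finsupp.single f 1) (Finsupp.single j 1), ← Finsupp.single_add] at h
    rw [← h]
    push_cast
    ring
  · unfold PointBlowup.direction
    rw [Function.update_of_ne hi.1, hb i hi.2, zero_mul]

end Step

end ResCone

end Summit.ResolutionOfSingularities.ResolutionOfSingularities.Theorems.PIDim4

end
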